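import Mathlib.LinearAlgebra.Dual.Lemmas
import Literature.AlgebraicGeometry.Kloosterman2025.PencilOfPairingsLeftKernel
import HarnessLib

/-!
# Kloosterman's dimension bounds for left kernels in a pencil of two pairings (Lemma 2.8, Lemma 2.9)

R. Kloosterman, *On a conjecture on Hodge loci of linear combinations of linear subvarieties*,
Rend. Circ. Mat. Palermo (2) (2025), doi:10.1007/s12215-025-01307-4 = arXiv:2312.12363, §2.3 'Bilinear maps'
[cite: Kloosterman2025, Notation 2.4, Lemma 2.8, Lemma 2.9] and §3 [cite: Kloosterman2025, Lemma 3.12, Cor. 3.14].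
Companion of `Literature/AlgebraicGeometry/Kloosterman2025/PencilOfPairingsLeftKernel.lean` (Lemma 2.9,
`leftKernel_add_smul_eq_bot`), whose encoding is kept: a pairing `φ : V × W → K` is a curried linear map
`B : V →ₗ[K] W →ₗ[K] K`, `ker_L(φ) = LinearMap.ker B`, `ker_R(φ) = LinearMap.ker B.flip`, over any field `K`.

**Printed setting [cite: Kloosterman2025, Notation 2.4] (verbatim).** "Let `V` and `W` be `ℂ`-vector spaces. For
`i = 1,2`, let `φ_i : V × W → ℂ` be bilinear maps. Let `V_i = ker_L(φ_i)`, `W_i = ker_R(φ_i)`. Suppose that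
`V₁ ∩ V₂ = 0` and `W₁ ∩ W₂ = 0`. Let `r_i = rank φ_i` and let `s_i = rank φ_j|_{V_i × W_i}`." (§2.3 opens: "We
will recall some well-known results on bilinear maps. We were not able to identify a place in the literature
containing the following results in the precise form we will need them.")

**Lemma 2.8 (verbatim).** "Using the above notation we have that for `{i,j} = {1,2}`:
`dim ker_L φ_j|_{V_i × W_i} ≤ r₁ + r₂ − dim W`." Printed proof (for `i = 1, j = 2`): "Let `a = r₁+r₂−dim V`, let
`b = r₁+r₂−dim W`. Then `dim V₁ = dim V − r₁ = r₂ − a`. Similar formula hold for `dim V₂, dim W₁` and `dim W₂`.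
Let `W'` be a subspace of `W` containing `W₁` and such that `W' ⊕ W₂ = W`. Then `φ₂|_{V₁×W}` has no left
kernel, and therefore its rank equals to the dimension of `V₁`, which equals `r₂ − a`. Since `W₁ ∩ W₂ = 0` it
follows that the rank of `φ₂|_{V₁×W'}` is also `r₂ − a`. Now `dim W' = dim W − dim W₂ = (r₁+r₂−b)−(r₁−b) = r₂`.
Hence the rank of `φ₂|_{V₁×W₁}` is at least `r₂−a−(dim W'−dim W₁)`, which equals `r₂−b−a`. Therefore the left
kernel has dimension at most `dim V₁ − (r₂−b−a) = b`."

**Lemma 2.9 (verbatim)** and its printed proof are quoted in the companion file; the step used here is: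
"Suppose now that `v ∈ ker_L(φ₁+λφ₂)` and that `λ ≠ 0`. Then for all `w ∈ ker_R(φ₂)` we have
`0 = φ₁(v,w)+λφ₂(v,w) = φ₁(v,w)`. This implies that `v` is in the orthogonal complement of `ker_R(φ₂)` with
respect to `φ₁`, since it is also in the orthogonal space of `ker_R(φ₁)` we obtain that `v` is in the orthogonal
space of `ker_R(φ₁)+ker_R(φ₂)` … with respect to `φ₁`", and `φ₁(v,·) = 0` forces `v ∈ V₁ ∩ V₂ = 0` (using
`λ ≠ 0`).

**What this file proves** (all sorry-free, over an arbitrary field `K`; `V`, `W` finite-dimensional where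
dimensions are counted). Both printed arguments have the same skeleton, which we isolate as
`finrank_add_finrank_le_of_pairing_eq_zero`: if `v ↦ φ(v,·)` is injective on a subspace `U ≤ V` and
`φ(U, W') = 0`, then `v ↦ φ(v,·)` embeds `U` into the annihilator of `W'`, so `dim U + dim W' ≤ dim W`.

* `finrank_range_flip_eq` — the rank of a pairing is well defined: `rank(w ↦ φ(·,w)) = rank(v ↦ φ(v,·))`
  (row rank = column rank, via Mathlib's `LinearMap.dualAnnihilator_ker_eq_range_flip`); this is the
  `r_i` of Notation 2.4, and `dim W_i = dim W − r_i` ("Similar formula hold for … `dim W₁` and `dim W₂`").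
* `mem_leftKernel_restrict_iff`, **`finrank_leftKernel_restrict_add_le`** — Lemma 2.8 for `(i,j) = (1,2)`
  (the other case is the same statement with the pairings swapped): the left kernel of `φ₂|_{V₁ × W₁}`,
  encoded as `ker B₁ ⊓ ker (W₁.dualRestrict ∘ₗ B₂)` with `W₁ = ker B₁.flip`, has
  `dim + dim W ≤ r₁ + r₂`. Our proof feeds `U =` that kernel, `φ = φ₂`, `W' = W₁ + W₂` to the skeleton
  (`φ₂(U, W₁) = 0` by definition of `U`, `φ₂(V, W₂) = 0` by definition of `W₂`; injectivity from
  `V₁ ∩ V₂ = 0`) and then counts `dim(W₁ + W₂) = (dim W − r₁) + (dim W − r₂)` using `W₁ ∩ W₂ = 0` — the same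
  ingredients as the printed rank count, arranged as one injection instead of a choice of complement `W'`.
* **`finrank_leftKernel_add_smul_add_finrank_sup_le`** — the dimension count contained in the printed proof
  of Lemma 2.9: for `c ≠ 0` and `V₁ ∩ V₂ = 0`, `v ↦ φ₁(v,·)` embeds `ker_L(φ₁ + cφ₂)` into the annihilator of
  `ker_R(φ₁) + ker_R(φ₂)`, hence `dim ker_L(φ₁ + cφ₂) + dim(ker_R φ₁ + ker_R φ₂) ≤ dim W`. Lemma 2.9 itself is
  the case `ker_R φ₁ + ker_R φ₂ = W` (re-derived below as `leftKernel_add_smul_eq_bot_of_sup_eq_top`, agreeing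
  with the companion file's `leftKernel_add_smul_eq_bot`).
* `finrank_leftKernel_add_smul_le` — the same count in the bookkeeping of the printed proofs of Lemma 2.9 and
  Cor. 3.14: if `ker_R φ₁ ∩ ker_R φ₂ = 0` and `dim ker_R φ₁ + dim ker_R φ₂ + H = dim W`, then
  `dim ker_L(φ₁ + cφ₂) ≤ H` for every `c ≠ 0`. In the Artinian Gorenstein setting of Lemma 2.9
  (`φ_j : S/(I₁∩I₂)_α × S/(I₁∩I₂)_{t−α} → (S/I_j)_t → ℂ`, `dim ker_R φ_j = h_{I₁∩I₂}(t−α) − h_{I_j}(t−α)` by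
  Gorenstein duality, as in the printed proof) this `H` is `h_{I₁}(t−α) + h_{I₂}(t−α) − h_{I₁∩I₂}(t−α)
  = h_{I₁+I₂}(t−α)`, the number the printed proof of Cor. 3.14 computes ("has dimension at most
  `h_{I₁}(d)+h_{I₂}(d)−h_{I₁∩I₂}(kd−2k−2)` … equals `h_{I₁+I₂}(d)`"); Lemma 2.9 is `H = 0`.
* `finrank_leftKernel_add_smul_add_finrank_le_rank` — the same bound in the `r_i` form of Lemma 2.8:
  `dim ker_L(φ₁ + cφ₂) + dim W ≤ r₁ + r₂` when `V₁ ∩ V₂ = 0`, `W₁ ∩ W₂ = 0`, `c ≠ 0`.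
* `finrank_leftKernel_add_smul_add_le_finrank_inf_add`, `finrank_leftKernel_add_smul_sub_le`,
  `ker_inf_ker_le_ker_add_smul` (section `BeforeQuotient`) — the same count run BEFORE the passage to the
  quotient `S/(I₁∩I₂)` of [cite: Kloosterman2025, Lemma 3.12], for arbitrary pairings `b₁, b₂ : S × S' → K` with no
  disjointness hypothesis: `dim ker_L(b₁+cb₂) − dim(ker_L b₁ ∩ ker_L b₂) ≤ dim S' − dim(ker_R b₁ + ker_R b₂)`
  (`c ≠ 0`), which for the Jacobian-ring pairings (`ker_L b_j = T_X NL(γ_j)`, [cite: Kloosterman2025, Lemma 3.6])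
  is literally `e(λ) ≤ h_{I₁+I₂}(kd−2k−2)` in the coordinates a computation uses.

**Use in the tree (why vendored).** By [cite: Kloosterman2025, Lemma 3.12], for two `k`-dimensional
subvarieties `Y₁, Y₂` of a smooth hypersurface `X ⊂ ℙ^{2k+1}` of degree `d`,
`T_X NL([Y₁]+λ[Y₂]) / T_X NL([Y₁],[Y₂]) = ker_L(ψ₁ + ν(λ)ψ₂)` with `ν(λ) ≠ 0`, the `ψ_j` being the pairings of
Lemma 2.9 with `t = (k+1)(d−2)`, `α = d`; the excess tangent dimension of [cite: Kloosterman2025, Def. 3.11] at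
`λ` is therefore `e(λ) = dim ker_L(ψ₁ + ν(λ)ψ₂)`, and `finrank_leftKernel_add_smul_le` reads
`e(λ) ≤ h_{I₁+I₂}(kd−2k−2)` for every `λ ∈ ℚ*` — the pointwise companion of Cor. 3.14 (`h_{I₁+I₂} = 0 ⇒ e ≡ 0`)
and of Thm. 3.13 (number of exceptional `λ`). The ideals `I_j`, Lemma 3.12, Gorenstein duality and the Hodge
loci are NOT formalised here; only the linear algebra of §2.3 is.
-/

namespace Literature.AlgebraicGeometry.Kloosterman2025

open Module

variable {K : Type*} [Field K] {V W : Type*} [AddCommGroup V] [Module K V] [AddCommGroup W] [Module K W]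

section Skeleton

/-- **The common skeleton of the printed proofs of Lemmas 2.8 and 2.9.** Let `φ : V × W → K` be a pairing,
`U ≤ V` a subspace meeting `ker_L(φ)` in `0` (so `v ↦ φ(v,·)` is injective on `U`) and `W' ≤ W` a subspace
with `φ(U, W') = 0`. Then `v ↦ φ(v,·)` embeds `U` into the annihilator of `W'` in `W^∨`, whence
`dim U + dim W' ≤ dim W`. [folklore; the mechanism of [cite: Kloosterman2025, Lemma 2.8, Lemma 2.9]] -/
theorem finrank_add_finrank_le_of_pairing_eq_zero [FiniteDimensional K W] (B : V →ₗ[K] W →ₗ[K] K)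
    (U : Submodule K V) (W' : Submodule K W) (hinj : U ⊓ LinearMap.ker B = ⊥)
    (hvan : ∀ v ∈ U, ∀ w ∈ W', B v w = 0) :
    finrank K U + finrank K W' ≤ finrank K W := by
  -- `f = (v ↦ φ(v,·))|_U : U → W^∨`
  let f : U →ₗ[K] Module.Dual K W := B.domRestrict U
  have hf : Function.Injective f := by
    rw [← LinearMap.ker_eq_bot]
    refine (Submodule.eq_bot_iff _).mpr ?_
    intro u hu
    have hBu : B (u : V) = 0 := by
      have h := LinearMap.mem_ker.mp hu
      simpa [f] using h
    have hu' : (u : V) ∈ U ⊓ LinearMap.ker B := Submodule.mem_inf.mpr ⟨u.2, LinearMap.mem_ker.mpr hBu⟩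
    rw [hinj] at hu'
    exact Subtype.ext ((Submodule.mem_bot K).mp hu')
  -- its image lies in the annihilator of `W'`
  have hrange : LinearMap.range f ≤ W'.dualAnnihilator := by
    rintro ψ ⟨u, rfl⟩
    refine (Submodule.mem_dualAnnihilator _).mpr ?_
    intro w hw
    have : f u w = B (u : V) w := rfl
    rw [this]
    exact hvan u u.2 w hw
  have h1 : finrank K (LinearMap.range f) = finrank K U := LinearMap.finrank_range_of_inj hf
  have h2 : finrank K (LinearMap.range f) ≤ finrank K W'.dualAnnihilator := Submodule.finrank_mono hrange
  have h3 := Subspace.finrank_add_finrank_dualAnnihilator_eq W'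
  omega

/-- **Row rank = column rank of a pairing** (`r_i = rank φ_i` of [cite: Kloosterman2025, Notation 2.4] is the
rank of either curried map): `dim range(w ↦ φ(·,w)) = dim range(v ↦ φ(v,·))`. Via Mathlib's
`LinearMap.dualAnnihilator_ker_eq_range_flip` (`(ker_L φ)^⊥ = range φ^flip`) and rank–nullity.
[folklore] -/
theorem finrank_range_flip_eq [FiniteDimensional K V] [FiniteDimensional K W] (B : V →ₗ[K] W →ₗ[K] K) :
    finrank K (LinearMap.range B.flip) = finrank K (LinearMap.range B) := by
  have h1 : finrank K (LinearMap.ker B) + finrank K (LinearMap.range B.flip) = finrank K V := by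
    rw [← LinearMap.dualAnnihilator_ker_eq_range_flip]
    exact Subspace.finrank_add_finrank_dualAnnihilator_eq _
  have h2 := LinearMap.finrank_range_add_finrank_ker B
  omega

/-- `dim ker_R(φ) = dim W − rank φ` ("Similar formula hold for `dim W₁` and `dim W₂`", printed proof of
Lemma 2.8; rank–nullity for `w ↦ φ(·,w)` plus `finrank_range_flip_eq`).
[folklore; [cite: Kloosterman2025, Lemma 2.8 (proof)]] -/
theorem finrank_ker_flip_add_finrank_range [FiniteDimensional K V] [FiniteDimensional K W]
    (B : V →ₗ[K] W →ₗ[K] K) :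
    finrank K (LinearMap.ker B.flip) + finrank K (LinearMap.range B) = finrank K W := by
  rw [← finrank_range_flip_eq B, add_comm]
  exact LinearMap.finrank_range_add_finrank_ker B.flip

end Skeleton

section Lemma28

/-- Membership in the left kernel of the restricted pairing `φ₂|_{V₁ × W₁}` (`V₁ = ker_L φ₁`, `W₁ = ker_R φ₁`),
encoded as the subspace `ker B₁ ⊓ ker (W₁.dualRestrict ∘ₗ B₂)` of `V`: `v` lies in it iff `φ₁(v,·) = 0` and
`φ₂(v,w) = 0` for every `w` with `φ₁(·,w) = 0`. [cite: Kloosterman2025, Notation 2.4, Lemma 2.8] -/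
theorem mem_leftKernel_restrict_iff (B₁ B₂ : V →ₗ[K] W →ₗ[K] K) (v : V) :
    v ∈ LinearMap.ker B₁ ⊓ LinearMap.ker ((LinearMap.ker B₁.flip).dualRestrict ∘ₗ B₂) ↔
      (∀ w, B₁ v w = 0) ∧ ∀ w, (∀ v', B₁ v' w = 0) → B₂ v w = 0 := by
  rw [Submodule.mem_inf, mem_ker_iff_forall]
  refine and_congr Iff.rfl ?_
  constructor
  · intro hv w hw
    have hw' : w ∈ LinearMap.ker B₁.flip := (mem_ker_flip_iff B₁ w).mpr hw
    have h := LinearMap.congr_fun (LinearMap.mem_ker.mp hv) ⟨w, hw'⟩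
    simpa [Submodule.dualRestrict_apply] using h
  · intro h
    refine LinearMap.mem_ker.mpr ?_
    ext ⟨w, hw⟩
    have hw' : ∀ v', B₁ v' w = 0 := (mem_ker_flip_iff B₁ w).mp hw
    simpa [Submodule.dualRestrict_apply] using h w hw'

/-- **Kloosterman, Lemma 2.8** (case `i = 1`, `j = 2`; swap `φ₁, φ₂` for the other case). With
`V_i = ker_L φ_i`, `W_i = ker_R φ_i`, `V₁ ∩ V₂ = 0`, `W₁ ∩ W₂ = 0` and `r_i = rank φ_i`:
`dim ker_L(φ₂|_{V₁ × W₁}) ≤ r₁ + r₂ − dim W`, stated additively as `dim ker_L(φ₂|_{V₁ × W₁}) + dim W ≤ r₁ + r₂`.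
Proof: `v ↦ φ₂(v,·)` is injective on that kernel (it lies in `V₁`, and `V₁ ∩ V₂ = 0`) and kills `W₁ + W₂`, a
subspace of dimension `(dim W − r₁) + (dim W − r₂)`; apply `finrank_add_finrank_le_of_pairing_eq_zero`.
[cite: Kloosterman2025, Lemma 2.8] -/
theorem finrank_leftKernel_restrict_add_le [FiniteDimensional K V] [FiniteDimensional K W]
    (B₁ B₂ : V →ₗ[K] W →ₗ[K] K) (hV : LinearMap.ker B₁ ⊓ LinearMap.ker B₂ = ⊥)
    (hW : LinearMap.ker B₁.flip ⊓ LinearMap.ker B₂.flip = ⊥) :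
    finrank K ↥(LinearMap.ker B₁ ⊓ LinearMap.ker ((LinearMap.ker B₁.flip).dualRestrict ∘ₗ B₂)) +
        finrank K W ≤
      finrank K (LinearMap.range B₁) + finrank K (LinearMap.range B₂) := by
  set U := LinearMap.ker B₁ ⊓ LinearMap.ker ((LinearMap.ker B₁.flip).dualRestrict ∘ₗ B₂) with hU
  have hcore := finrank_add_finrank_le_of_pairing_eq_zero B₂ U
    (LinearMap.ker B₁.flip ⊔ LinearMap.ker B₂.flip) ?_ ?_
  · have hsup := Submodule.finrank_sup_add_finrank_inf_eq (LinearMap.ker B₁.flip) (LinearMap.ker B₂.flip)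
    rw [hW, finrank_bot, add_zero] at hsup
    have h1 := finrank_ker_flip_add_finrank_range B₁
    have h2 := finrank_ker_flip_add_finrank_range B₂
    omega
  · -- injectivity of `v ↦ φ₂(v,·)` on `U ≤ V₁`
    refine (Submodule.eq_bot_iff _).mpr ?_
    intro v hv
    obtain ⟨hvU, hv2⟩ := Submodule.mem_inf.mp hv
    have hv1 : v ∈ LinearMap.ker B₁ := (Submodule.mem_inf.mp hvU).1
    have : v ∈ LinearMap.ker B₁ ⊓ LinearMap.ker B₂ := Submodule.mem_inf.mpr ⟨hv1, hv2⟩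
    rw [hV] at this
    exact (Submodule.mem_bot K).mp this
  · -- `φ₂(U, W₁ + W₂) = 0`
    intro v hv w hw
    obtain ⟨w₁, hw₁, w₂, hw₂, rfl⟩ := Submodule.mem_sup.mp hw
    obtain ⟨-, hres⟩ := (mem_leftKernel_restrict_iff B₁ B₂ v).mp hv
    have a : B₂ v w₁ = 0 := hres w₁ ((mem_ker_flip_iff B₁ w₁).mp hw₁)
    have b : B₂ v w₂ = 0 := (mem_ker_flip_iff B₂ w₂).mp hw₂ v
    rw [map_add, a, b, add_zero]

end Lemma28

section Lemma29

/-- **The dimension count in the printed proof of Lemma 2.9.** If the left kernels of `φ₁, φ₂` meet in `0`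
(`V₁ ∩ V₂ = 0`) and `c ≠ 0`, then `v ↦ φ₁(v,·)` embeds `ker_L(φ₁ + cφ₂)` into the annihilator of
`ker_R(φ₁) + ker_R(φ₂)` ("`v` is in the orthogonal space of `ker_R(φ₁)+ker_R(φ₂)` with respect to `φ₁`";
injective because `φ₁(v,·) = 0` forces `cφ₂(v,·) = 0`, so `v ∈ V₁ ∩ V₂ = 0`). Hence
`dim ker_L(φ₁ + cφ₂) + dim(ker_R φ₁ + ker_R φ₂) ≤ dim W`; Lemma 2.9 is the case `ker_R φ₁ + ker_R φ₂ = W`.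
[cite: Kloosterman2025, Lemma 2.9 (proof)] -/
theorem finrank_leftKernel_add_smul_add_finrank_sup_le [FiniteDimensional K W]
    (B₁ B₂ : V →ₗ[K] W →ₗ[K] K) (hL : LinearMap.ker B₁ ⊓ LinearMap.ker B₂ = ⊥) {c : K} (hc : c ≠ 0) :
    finrank K (LinearMap.ker (B₁ + c • B₂)) +
        finrank K ↥(LinearMap.ker B₁.flip ⊔ LinearMap.ker B₂.flip) ≤ finrank K W := by
  refine finrank_add_finrank_le_of_pairing_eq_zero B₁ _ _ ?_ ?_
  · -- `v ∈ ker_L(φ₁ + cφ₂)` with `φ₁(v,·) = 0` ⇒ `cφ₂(v,·) = 0` ⇒ `v ∈ V₁ ∩ V₂ = 0`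
    refine (Submodule.eq_bot_iff _).mpr ?_
    intro v hv
    obtain ⟨hv12, hv1⟩ := Submodule.mem_inf.mp hv
    have h1 : ∀ w, B₁ v w = 0 := (mem_ker_iff_forall B₁ v).mp hv1
    have h12 : ∀ w, B₁ v w + c * B₂ v w = 0 := fun w => by
      have h := (mem_ker_iff_forall (B₁ + c • B₂) v).mp hv12 w
      simpa using h
    have h2 : v ∈ LinearMap.ker B₂ := by
      refine (mem_ker_iff_forall B₂ v).mpr fun w => ?_
      have h := h12 w
      rw [h1 w, zero_add] at h
      exact (mul_eq_zero.mp h).resolve_left hc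
    have : v ∈ LinearMap.ker B₁ ⊓ LinearMap.ker B₂ := Submodule.mem_inf.mpr ⟨hv1, h2⟩
    rw [hL] at this
    exact (Submodule.mem_bot K).mp this
  · -- `φ₁(v, W₁ + W₂) = 0` for `v ∈ ker_L(φ₁ + cφ₂)`
    intro v hv w hw
    obtain ⟨w₁, hw₁, w₂, hw₂, rfl⟩ := Submodule.mem_sup.mp hw
    have hv' : ∀ w, B₁ v w + c * B₂ v w = 0 := fun w => by
      have h := (mem_ker_iff_forall (B₁ + c • B₂) v).mp hv w
      simpa using h
    have a : B₁ v w₁ = 0 := (mem_ker_flip_iff B₁ w₁).mp hw₁ v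
    have b2 : B₂ v w₂ = 0 := (mem_ker_flip_iff B₂ w₂).mp hw₂ v
    have b : B₁ v w₂ = 0 := by
      have h := hv' w₂
      rwa [b2, mul_zero, add_zero] at h
    rw [map_add, a, b, add_zero]

/-- Lemma 2.9 recovered from the count (finite-dimensional `V`, `W`): if moreover `ker_R φ₁ + ker_R φ₂ = W`
then `dim ker_L(φ₁ + cφ₂) = 0`, i.e. `ker_L(φ₁ + cφ₂) = 0` (the companion file's `leftKernel_add_smul_eq_bot`
proves this directly, without finiteness). [cite: Kloosterman2025, Lemma 2.9] -/
theorem leftKernel_add_smul_eq_bot_of_sup_eq_top [FiniteDimensional K V] [FiniteDimensional K W]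
    (B₁ B₂ : V →ₗ[K] W →ₗ[K] K) (hL : LinearMap.ker B₁ ⊓ LinearMap.ker B₂ = ⊥)
    (hR : LinearMap.ker B₁.flip ⊔ LinearMap.ker B₂.flip = ⊤) {c : K} (hc : c ≠ 0) :
    LinearMap.ker (B₁ + c • B₂) = ⊥ := by
  have h := finrank_leftKernel_add_smul_add_finrank_sup_le B₁ B₂ hL hc
  rw [hR, finrank_top] at h
  have h0 : finrank K (LinearMap.ker (B₁ + c • B₂)) = 0 := by omega
  exact Submodule.finrank_eq_zero.mp h0

/-- **Pointwise bound on the excess dimension, in the bookkeeping of the printed proofs of Lemma 2.9 and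
Cor. 3.14.** If the left kernels of `φ₁, φ₂` meet in `0`, the right kernels meet in `0`, and
`dim ker_R φ₁ + dim ker_R φ₂ + H = dim W`, then `dim ker_L(φ₁ + cφ₂) ≤ H` for every `c ≠ 0`. In the setting
of Lemma 2.9 (`φ_j : S/(I₁∩I₂)_α × S/(I₁∩I₂)_{t−α} → (S/I_j)_t → ℂ`, `S/I_j` Artinian Gorenstein of socle
degree `t`), `dim ker_R φ_j = h_{I₁∩I₂}(t−α) − h_{I_j}(t−α)`, so
`H = h_{I₁}(t−α) + h_{I₂}(t−α) − h_{I₁∩I₂}(t−α) = h_{I₁+I₂}(t−α)` (the quantity computed in the printed proof of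
Cor. 3.14); `H = 0` is Lemma 2.9. Read through [cite: Kloosterman2025, Lemma 3.12] this is
`e(λ) ≤ h_{I₁+I₂}(kd−2k−2)` for the excess tangent dimension of `NL([Y₁]+λ[Y₂])` at every `λ ∈ ℚ*`.
[cite: Kloosterman2025, Lemma 2.9 (proof), Cor. 3.14 (proof)] -/
theorem finrank_leftKernel_add_smul_le [FiniteDimensional K W] (B₁ B₂ : V →ₗ[K] W →ₗ[K] K)
    (hL : LinearMap.ker B₁ ⊓ LinearMap.ker B₂ = ⊥)
    (hRdisj : LinearMap.ker B₁.flip ⊓ LinearMap.ker B₂.flip = ⊥) {H : ℕ}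
    (hRdim : finrank K (LinearMap.ker B₁.flip) + finrank K (LinearMap.ker B₂.flip) + H = finrank K W)
    {c : K} (hc : c ≠ 0) :
    finrank K (LinearMap.ker (B₁ + c • B₂)) ≤ H := by
  have h := finrank_leftKernel_add_smul_add_finrank_sup_le B₁ B₂ hL hc
  have hsup := Submodule.finrank_sup_add_finrank_inf_eq (LinearMap.ker B₁.flip) (LinearMap.ker B₂.flip)
  rw [hRdisj, finrank_bot, add_zero] at hsup
  omega

/-- The same bound in the `r_i`-form of Lemma 2.8: with `V₁ ∩ V₂ = 0`, `W₁ ∩ W₂ = 0` and `c ≠ 0`,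
`dim ker_L(φ₁ + cφ₂) + dim W ≤ r₁ + r₂` (`r_i = rank φ_i`), i.e. `dim ker_L(φ₁ + cφ₂) ≤ r₁ + r₂ − dim W`,
the number `b` bounding the restricted kernels in Lemma 2.8.
[cite: Kloosterman2025, Lemma 2.8, Lemma 2.9 (proof)] -/
theorem finrank_leftKernel_add_smul_add_finrank_le_rank [FiniteDimensional K V] [FiniteDimensional K W]
    (B₁ B₂ : V →ₗ[K] W →ₗ[K] K) (hL : LinearMap.ker B₁ ⊓ LinearMap.ker B₂ = ⊥)
    (hRdisj : LinearMap.ker B₁.flip ⊓ LinearMap.ker B₂.flip = ⊥) {c : K} (hc : c ≠ 0) :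
    finrank K (LinearMap.ker (B₁ + c • B₂)) + finrank K W ≤
      finrank K (LinearMap.range B₁) + finrank K (LinearMap.range B₂) := by
  have h := finrank_leftKernel_add_smul_add_finrank_sup_le B₁ B₂ hL hc
  have hsup := Submodule.finrank_sup_add_finrank_inf_eq (LinearMap.ker B₁.flip) (LinearMap.ker B₂.flip)
  rw [hRdisj, finrank_bot, add_zero] at hsup
  have h1 := finrank_ker_flip_add_finrank_range B₁
  have h2 := finrank_ker_flip_add_finrank_range B₂
  omega

end Lemma29

section BeforeQuotient

/-!
### The same count before passing to the quotient (Lemma 3.12 + Lemma 2.9, abstract form)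

[cite: Kloosterman2025, Lemma 3.12] passes from the multiplication pairings `b_j : S_d × S_{t−d} → S_t/f_{γ_j}^⊥ ≅ ℂ`
(`b_j(P,Q) = σ_j(PQ)`; by [cite: Kloosterman2025, Construction 3.1] `I(γ_j)` is the largest ideal with
`I(γ_j)_t = f_{γ_j}^⊥`, so `ker_L b_j = I(γ_j)_d`, `ker_R b_j = I(γ_j)_{t−d}`; `I(γ_j)_d = T_X NL(γ_j)` by
[cite: Kloosterman2025, Lemma 3.6], `ker_L b₁ ∩ ker_L b₂ = T_X NL(γ₁,γ₂)` by [cite: Kloosterman2025, Rem. 3.8], and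
`ker_L(b₁+λb₂) = I(γ₁+λγ₂)_d = T_X NL(γ₁+λγ₂)` since `f_{γ₁+λγ₂} = f_{γ₁} + λf_{γ₂}`) to the pairings `ψ_j`
induced on the quotients `V = (S/I₁∩I₂)_d`, `W = (S/I₁∩I₂)_{t−d}`, where
`T_X NL(γ₁+λγ₂)/T_X NL(γ₁,γ₂) = ker_L(ψ₁+νψ₂)` and the hypotheses `V₁ ∩ V₂ = 0`, `W₁ ∩ W₂ = 0` of Notation 2.4
hold automatically. The dimension count of Lemma 2.9 can be run BEFORE taking the quotient, with the same
one-line mechanism: for arbitrary pairings `b₁, b₂ : S × S' → K` and `c ≠ 0`, `v ↦ b₁(v,·)` maps `ker_L(b₁+cb₂)`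
into the annihilator of `ker_R b₁ + ker_R b₂` with kernel exactly `ker_L b₁ ∩ ker_L b₂`. This gives the excess
bound in the form a computation meets it (no quotient, no disjointness hypothesis):
`dim ker_L(b₁+cb₂) − dim(ker_L b₁ ∩ ker_L b₂) ≤ dim S' − dim(ker_R b₁ + ker_R b₂)`, i.e. for the Jacobian-ring
pairings `e(λ) ≤ dim S_{t−d} − dim(I_{1,t−d} + I_{2,t−d}) = h_{I₁+I₂}(t−d)`.
-/

/-- **Excess bound before the quotient** (abstract Lemma 3.12 + the count of Lemma 2.9): for ANY two pairings
`b₁, b₂ : S × S' → K` of finite-dimensional spaces and `c ≠ 0`,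
`dim ker_L(b₁ + cb₂) + dim(ker_R b₁ + ker_R b₂) ≤ dim(ker_L b₁ ∩ ker_L b₂) + dim S'`, i.e.
`e(c) := dim ker_L(b₁ + cb₂) − dim(ker_L b₁ ∩ ker_L b₂) ≤ dim S' − dim(ker_R b₁ + ker_R b₂)`. Proof: restrict
`v ↦ b₁(v,·)` to `U = ker_L(b₁ + cb₂)`; its image annihilates `ker_R b₁ + ker_R b₂` (as in the printed proof of
Lemma 2.9) and its kernel `{v ∈ U : b₁(v,·) = 0} = ker_L b₁ ∩ ker_L b₂` (using `c ≠ 0`); rank–nullity on `U`.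
With `b_j` the Jacobian-ring pairings of [cite: Kloosterman2025, Construction 3.1, Lemma 3.6, Lemma 3.12]
(`ker_L b_j = T_X NL(γ_j)`) this reads `e(λ) ≤ h_{I₁+I₂}(kd−2k−2)` for every `λ ∈ ℚ*`.
[cite: Kloosterman2025, Lemma 2.9 (proof), Lemma 3.12] -/
theorem finrank_leftKernel_add_smul_add_le_finrank_inf_add [FiniteDimensional K V] [FiniteDimensional K W]
    (B₁ B₂ : V →ₗ[K] W →ₗ[K] K) {c : K} (hc : c ≠ 0) :
    finrank K (LinearMap.ker (B₁ + c • B₂)) + finrank K ↥(LinearMap.ker B₁.flip ⊔ LinearMap.ker B₂.flip) ≤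
      finrank K ↥(LinearMap.ker B₁ ⊓ LinearMap.ker B₂) + finrank K W := by
  set U : Submodule K V := LinearMap.ker (B₁ + c • B₂) with hU
  -- `f = (v ↦ b₁(v,·))|_U : U → W^∨`
  let f : U →ₗ[K] Module.Dual K W := B₁.domRestrict U
  have hv' : ∀ v ∈ U, ∀ w, B₁ v w + c * B₂ v w = 0 := fun v hv w => by
    have h := (mem_ker_iff_forall (B₁ + c • B₂) v).mp hv w
    simpa using h
  -- (i) the image annihilates `ker_R b₁ + ker_R b₂`
  have hrange : LinearMap.range f ≤ (LinearMap.ker B₁.flip ⊔ LinearMap.ker B₂.flip).dualAnnihilator := by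
    rintro ψ ⟨u, rfl⟩
    refine (Submodule.mem_dualAnnihilator _).mpr ?_
    intro w hw
    obtain ⟨w₁, hw₁, w₂, hw₂, rfl⟩ := Submodule.mem_sup.mp hw
    have a : B₁ (u : V) w₁ = 0 := (mem_ker_flip_iff B₁ w₁).mp hw₁ u
    have b2 : B₂ (u : V) w₂ = 0 := (mem_ker_flip_iff B₂ w₂).mp hw₂ u
    have b : B₁ (u : V) w₂ = 0 := by
      have h := hv' u u.2 w₂
      rwa [b2, mul_zero, add_zero] at h
    have : f u (w₁ + w₂) = B₁ (u : V) w₁ + B₁ (u : V) w₂ := by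
      simp only [f, LinearMap.domRestrict_apply, map_add]
    rw [this, a, b, add_zero]
  -- (ii) the kernel of `f` sits inside `ker_L b₁ ∩ ker_L b₂`
  have hker : (LinearMap.ker f).map U.subtype ≤ LinearMap.ker B₁ ⊓ LinearMap.ker B₂ := by
    rintro v ⟨u, hu, rfl⟩
    have h1 : B₁ (u : V) = 0 := by
      have h := LinearMap.mem_ker.mp hu
      simpa [f] using h
    have h1' : ∀ w, B₁ (u : V) w = 0 := fun w => by rw [h1, LinearMap.zero_apply]
    refine Submodule.mem_inf.mpr ⟨LinearMap.mem_ker.mpr h1, (mem_ker_iff_forall B₂ _).mpr fun w => ?_⟩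
    have h := hv' u u.2 w
    rw [h1' w, zero_add] at h
    exact (mul_eq_zero.mp h).resolve_left hc
  -- (iii) rank–nullity on `U` and the annihilator dimension formula
  have h1 := LinearMap.finrank_range_add_finrank_ker f
  have h2 : finrank K (LinearMap.range f) ≤
      finrank K (LinearMap.ker B₁.flip ⊔ LinearMap.ker B₂.flip).dualAnnihilator := Submodule.finrank_mono hrange
  have h3 := Subspace.finrank_add_finrank_dualAnnihilator_eq (LinearMap.ker B₁.flip ⊔ LinearMap.ker B₂.flip)
  have h4 : finrank K (LinearMap.ker f) ≤ finrank K ↥(LinearMap.ker B₁ ⊓ LinearMap.ker B₂) := by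
    rw [← Submodule.finrank_map_subtype_eq U (LinearMap.ker f)]
    exact Submodule.finrank_mono hker
  omega

/-- Truncated reading: the excess `dim ker_L(b₁ + cb₂) − dim(ker_L b₁ ∩ ker_L b₂)` is at most
`dim S' − dim(ker_R b₁ + ker_R b₂)` for every `c ≠ 0` (`= h_{I₁+I₂}(t−d)` for the Jacobian-ring pairings).
[cite: Kloosterman2025, Lemma 2.9 (proof), Lemma 3.12] -/
theorem finrank_leftKernel_add_smul_sub_le [FiniteDimensional K V] [FiniteDimensional K W]
    (B₁ B₂ : V →ₗ[K] W →ₗ[K] K) {c : K} (hc : c ≠ 0) :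
    finrank K (LinearMap.ker (B₁ + c • B₂)) - finrank K ↥(LinearMap.ker B₁ ⊓ LinearMap.ker B₂) ≤
      finrank K W - finrank K ↥(LinearMap.ker B₁.flip ⊔ LinearMap.ker B₂.flip) := by
  have h := finrank_leftKernel_add_smul_add_le_finrank_inf_add B₁ B₂ hc
  have h' : finrank K ↥(LinearMap.ker B₁.flip ⊔ LinearMap.ker B₂.flip) ≤ finrank K W :=
    Submodule.finrank_le _
  omega

/-- The excess is also monotone in the obvious direction: `ker_L b₁ ∩ ker_L b₂ ≤ ker_L(b₁ + cb₂)` for every `c`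
(the "obvious inclusion `NL([Π₁],[Π₂]) ⊂ NL([Π₁]+λ[Π₂])`" at tangent level, [cite: Kloosterman2025, Rem. 3.8,
proof of Prop. 4.6]). -/
theorem ker_inf_ker_le_ker_add_smul (B₁ B₂ : V →ₗ[K] W →ₗ[K] K) (c : K) :
    LinearMap.ker B₁ ⊓ LinearMap.ker B₂ ≤ LinearMap.ker (B₁ + c • B₂) := by
  intro v hv
  obtain ⟨h1, h2⟩ := Submodule.mem_inf.mp hv
  rw [LinearMap.mem_ker] at h1 h2 ⊢
  simp [h1, h2]

end BeforeQuotient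

end Literature.AlgebraicGeometry.Kloosterman2025
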